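import Mathlib

/-!
# Lever lemmas I for `OrbitClusterBound` — clustered-rows determinant bound and multi-index counting

Line `orbit-interpolation-determinant` for the crux `ApproximationProperty` (stmt-Schanuel-6117, route
DiophantineDichotomy), stub `stub_orbitClusterBound` (the lever, proved by the line lead in
`DiophantineDichotomyApproximationPropertyOrbitClusterBound.lean`, which imports this file).
Everything here is PROVED; no definitions, no named facts.

* `norm_det_le_of_cluster`: if the rows `a ∈ S` of a complex square matrix `W` are finite sums
  `W a = ∑_{γ ∈ Γ} u a γ • w γ` of FIXED vectors `w γ` with coefficients `‖u a γ‖ ≤ r ^ deg γ`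
  (`0 ≤ r ≤ 1`), then expanding `det W` multilinearly in those rows, killing the terms with a
  repeated `γ` (two equal rows) and bounding the survivors by the Leibniz expansion gives
  `‖det W‖ ≤ #Γ ^ #S · r ^ m · (#n)! · B ^ #S · ∏_{a ∉ S} R a` for any `m ≤ ∑_{a ∈ S} deg (p a)`
  over assignments `p` injective on `S` (the EXACT Taylor rows of the interpolation determinant).
* `quarter_rpow_sub_le_sum_tdeg`: `k` distinct multi-indices of `ℕᵗ` have total degree
  `∑ |γ| ≥ ¼ k^{1+1/t} − k` (at most `sᵗ` of them have `|γ| < s`; take `s = ⌊(k/2)^{1/t}⌋`).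

Source of the mechanism: the card `orbit-interpolation-determinant` (Galois-orbit Vandermonde,
a `t`-dimensional Lemma A.8); LaurentRoy1999 Lemmas 3–4 is the `t = 1` discriminant device.
-/

open Finset Matrix

-- `Summit.Schanuel.Schanuel.…` is the mandated summit/sub-problem namespace (single-conjunct summit):
set_option linter.dupNamespace false

namespace Summit.Schanuel.Schanuel.Cruxes.ApproximationProperty.OrbitInterpolationDeterminant


/-- Leibniz bound: `‖det M‖ ≤ (#n)! · ∏ₐ Cₐ` if every entry of row `a` has norm `≤ Cₐ`. -/
theorem norm_det_le_factorial_mul_prod {n : Type*} [Fintype n] [DecidableEq n]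
    (M : Matrix n n ℂ) (C : n → ℝ) (hC : ∀ a j, ‖M a j‖ ≤ C a) :
    ‖M.det‖ ≤ (Fintype.card n).factorial * ∏ a, C a := by
  rw [Matrix.det_apply]
  refine (norm_sum_le _ _).trans ?_
  have hterm : ∀ σ : Equiv.Perm n,
      ‖Equiv.Perm.sign σ • ∏ a, M (σ a) a‖ ≤ ∏ a, C a := by
    intro σ
    have hs : ‖Equiv.Perm.sign σ • ∏ a, M (σ a) a‖ = ‖∏ a, M (σ a) a‖ := by
      rcases Int.units_eq_one_or (Equiv.Perm.sign σ) with h | h <;>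
        simp [h, Units.smul_def]
    calc ‖Equiv.Perm.sign σ • ∏ a, M (σ a) a‖
        = ∏ a, ‖M (σ a) a‖ := by rw [hs, norm_prod]
      _ ≤ ∏ a, C (σ a) := prod_le_prod (fun a _ => norm_nonneg _) fun a _ => hC _ _
      _ = ∏ a, C a := Equiv.prod_comp σ C
  calc ∑ σ : Equiv.Perm n, ‖Equiv.Perm.sign σ • ∏ a, M (σ a) a‖
      ≤ ∑ _σ : Equiv.Perm n, ∏ a, C a := sum_le_sum fun σ _ => hterm σ
    _ = (Fintype.card n).factorial * ∏ a, C a := by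
        rw [sum_const, nsmul_eq_mul, Finset.card_univ, Fintype.card_perm]

/-- Row scaling: `det (a ↦ c a • M a) = (∏ c) · det M`. -/
theorem det_smul_rows {n : Type*} [Fintype n] [DecidableEq n] (c : n → ℂ) (M : Matrix n n ℂ) :
    Matrix.det (fun a j => c a * M a j) = (∏ a, c a) * M.det :=
  Matrix.det_mul_column c M

/-- **Clustered-rows determinant bound.** Rows in `S` are sums over `Γ` of fixed vectors `w γ`
with coefficients of size `≤ r ^ deg γ`; any `m` bounding `∑_{a∈S} deg (p a)` from below over
assignments injective on `S` gives `‖det W‖ ≤ #Γ^#S · r^m · (#n)! · B^#S · ∏_{a∉S} R a`. -/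
theorem norm_det_le_of_cluster {n X : Type*} [Fintype n] [DecidableEq n] [DecidableEq X]
    (W : Matrix n n ℂ) (S : Finset n) (Γ : Finset X) (hΓ : Γ.Nonempty)
    (u : n → X → ℂ) (w : X → n → ℂ) (deg : X → ℕ) (r B : ℝ) (R : n → ℝ) (m : ℕ)
    (hr0 : 0 ≤ r) (hr1 : r ≤ 1) (hB : 0 ≤ B) (hR : ∀ a, 0 ≤ R a)
    (hrow : ∀ a ∈ S, W a = ∑ γ ∈ Γ, u a γ • w γ)
    (hu : ∀ a ∈ S, ∀ γ ∈ Γ, ‖u a γ‖ ≤ r ^ deg γ)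
    (hw : ∀ γ ∈ Γ, ∀ j, ‖w γ j‖ ≤ B)
    (hW : ∀ a ∉ S, ∀ j, ‖W a j‖ ≤ R a)
    (hm : ∀ p : n → X, (∀ a ∈ S, p a ∈ Γ) → Set.InjOn p S → m ≤ ∑ a ∈ S, deg (p a)) :
    ‖W.det‖ ≤ (Γ.card : ℝ) ^ S.card * r ^ m * (Fintype.card n).factorial * B ^ S.card *
      ∏ a ∈ univ.filter (· ∉ S), R a := by
  classical
  obtain ⟨γ₀, hγ₀⟩ := hΓ
  -- the row families
  let A : n → Finset X := fun a => if a ∈ S then Γ else {γ₀}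
  let g : n → X → (n → ℂ) := fun a x => if a ∈ S then u a x • w x else W a
  have hWg : W = fun a => ∑ x ∈ A a, g a x := by
    funext a
    by_cases ha : a ∈ S
    · simp only [A, g, if_pos ha]; exact hrow a ha
    · simp only [A, g, if_neg ha, sum_singleton]
  -- multilinear expansion
  have hexp : W.det = ∑ p ∈ Fintype.piFinset A, Matrix.det (fun a => g a (p a)) := by
    have h := MultilinearMap.map_sum_finset
      (Matrix.detRowAlternating : (n → ℂ) [⋀^n]→ₗ[ℂ] ℂ).toMultilinearMap g A
    rw [hWg]
    exact h
  -- each term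
  have hterm : ∀ p ∈ Fintype.piFinset A,
      ‖Matrix.det (fun a => g a (p a))‖ ≤
        r ^ m * (Fintype.card n).factorial * B ^ S.card * ∏ a ∈ univ.filter (· ∉ S), R a := by
    intro p hp
    have hpA : ∀ a, p a ∈ A a := fun a => Fintype.mem_piFinset.mp hp a
    have hpS : ∀ a ∈ S, p a ∈ Γ := fun a ha => by simpa [A, if_pos ha] using hpA a
    -- factor the scalars out
    let c : n → ℂ := fun a => if a ∈ S then u a (p a) else 1
    let M : Matrix n n ℂ := fun a => if a ∈ S then w (p a) else W a
    have hgM : (fun a => g a (p a)) = fun a j => c a * M a j := by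
      funext a j
      by_cases ha : a ∈ S <;> simp [g, c, M, ha, Pi.smul_apply, smul_eq_mul]
    rw [hgM, det_smul_rows]
    by_cases hinj : Set.InjOn p S
    · -- injective on S: bound scalars by r^m and the determinant by Leibniz
      have hc : ‖∏ a, c a‖ ≤ r ^ m := by
        rw [norm_prod]
        have h1 : ∏ a, ‖c a‖ = ∏ a ∈ S, ‖u a (p a)‖ := by
          rw [← Finset.prod_filter_mul_prod_filter_not univ (· ∈ S)]
          have e1 : univ.filter (· ∈ S) = S := by ext a; simp
          rw [e1]
          have e2 : ∏ a ∈ univ.filter (fun a => ¬ a ∈ S), ‖c a‖ = 1 :=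
            prod_eq_one fun a ha => by
              simp only [mem_filter, mem_univ, true_and] at ha
              simp [c, ha]
          rw [e2, mul_one]
          exact prod_congr rfl fun a ha => by simp [c, ha]
        rw [h1]
        calc ∏ a ∈ S, ‖u a (p a)‖ ≤ ∏ a ∈ S, r ^ deg (p a) :=
              prod_le_prod (fun a _ => norm_nonneg _) fun a ha => hu a ha _ (hpS a ha)
          _ = r ^ ∑ a ∈ S, deg (p a) := by rw [prod_pow_eq_pow_sum]
          _ ≤ r ^ m := pow_le_pow_of_le_one hr0 hr1 (hm p hpS hinj)
      have hM : ‖M.det‖ ≤ (Fintype.card n).factorial *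
          ∏ a, (if a ∈ S then B else R a) := by
        refine norm_det_le_factorial_mul_prod M _ fun a j => ?_
        by_cases ha : a ∈ S
        · simp only [M, if_pos ha]; exact hw _ (hpS a ha) j
        · simp only [M, if_neg ha]; exact hW a ha j
      have hsplit : ∏ a, (if a ∈ S then B else R a) = B ^ S.card * ∏ a ∈ univ.filter (· ∉ S), R a := by
        rw [← Finset.prod_filter_mul_prod_filter_not univ (· ∈ S)]
        have e1 : univ.filter (· ∈ S) = S := by ext a; simp
        rw [e1, prod_ite_of_true (fun a ha => ha), prod_const]
        congr 1
        exact prod_congr rfl fun a ha => by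
          simp only [mem_filter, mem_univ, true_and] at ha
          simp [ha]
      rw [norm_mul]
      calc ‖∏ a, c a‖ * ‖M.det‖
          ≤ r ^ m * ((Fintype.card n).factorial * ∏ a, (if a ∈ S then B else R a)) :=
            mul_le_mul hc hM (norm_nonneg _) (pow_nonneg hr0 _)
        _ = _ := by rw [hsplit]; ring
    · -- two equal rows
      rw [Set.InjOn] at hinj
      push Not at hinj
      obtain ⟨a, ha, a', ha', hpp, hne⟩ := hinj
      rw [Finset.mem_coe] at ha ha'
      have hdet : M.det = 0 := by
        refine Matrix.det_zero_of_row_eq hne ?_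
        simp [M, ha, ha', hpp]
      rw [hdet, mul_zero, norm_zero]
      have : 0 ≤ ∏ a ∈ univ.filter (· ∉ S), R a := prod_nonneg fun a _ => hR a
      positivity
  -- sum up
  rw [hexp]
  refine (norm_sum_le _ _).trans ?_
  refine (sum_le_sum hterm).trans ?_
  rw [sum_const, nsmul_eq_mul, Fintype.card_piFinset]
  have hcard : (∏ a, ((A a).card : ℝ)) = (Γ.card : ℝ) ^ S.card := by
    rw [← Finset.prod_filter_mul_prod_filter_not univ (· ∈ S)]
    have e1 : univ.filter (· ∈ S) = S := by ext a; simp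
    rw [e1]
    have e2 : ∏ a ∈ univ.filter (fun a => ¬ a ∈ S), ((A a).card : ℝ) = 1 :=
      prod_eq_one fun a ha => by
        simp only [mem_filter, mem_univ, true_and] at ha
        simp [A, ha]
    rw [e2, mul_one, ← prod_const]
    exact prod_congr rfl fun a ha => by simp [A, ha]
  rw [Nat.cast_prod, hcard]
  ring_nf
  rfl


/-- At most `s ^ t` multi-indices of `ℕᵗ` in any finite set have total degree `< s`. -/
theorem card_filter_tdeg_lt_le {t : ℕ} (T : Finset (Fin t → ℕ)) (s : ℕ) :
    (T.filter fun γ => (∑ l, γ l) < s).card ≤ s ^ t := by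
  classical
  -- such a `γ` has every coordinate `< s`: inject into `Fin t → Fin s`
  have hsub : T.filter (fun γ => (∑ l, γ l) < s) ⊆
      (univ : Finset (Fin t → Fin s)).image fun f l => (f l : ℕ) := by
    intro γ hγ
    rw [mem_filter] at hγ
    have hl : ∀ l, γ l < s := fun l =>
      lt_of_le_of_lt (single_le_sum (fun i _ => Nat.zero_le (γ i)) (mem_univ l)) hγ.2
    exact mem_image.mpr ⟨fun l => ⟨γ l, hl l⟩, mem_univ _, rfl⟩
  calc (T.filter fun γ => (∑ l, γ l) < s).card
      ≤ ((univ : Finset (Fin t → Fin s)).image fun f l => (f l : ℕ)).card := card_le_card hsub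
    _ ≤ (univ : Finset (Fin t → Fin s)).card := card_image_le
    _ = s ^ t := by simp

/-- `∑_{γ ∈ T} |γ| ≥ s · (#T − sᵗ)` for every `s`. -/
theorem mul_sub_le_sum_tdeg {t : ℕ} (T : Finset (Fin t → ℕ)) (s : ℕ) :
    (s : ℝ) * (T.card - (s : ℝ) ^ t) ≤ ∑ γ ∈ T, ((∑ l, γ l : ℕ) : ℝ) := by
  classical
  set P : (Fin t → ℕ) → Prop := fun γ => (∑ l, γ l) < s with hP
  have hsplit := (card_filter_add_card_filter_not (s := T) P)
  have hbig : (s : ℝ) * (T.filter fun γ => ¬ P γ).card ≤ ∑ γ ∈ T.filter (fun γ => ¬ P γ), ((∑ l, γ l : ℕ) : ℝ) := by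
    rw [mul_comm, ← nsmul_eq_mul, ← sum_const]
    refine sum_le_sum fun γ hγ => ?_
    rw [mem_filter] at hγ
    exact_mod_cast not_lt.mp hγ.2
  have hle : ∑ γ ∈ T.filter (fun γ => ¬ P γ), ((∑ l, γ l : ℕ) : ℝ) ≤ ∑ γ ∈ T, ((∑ l, γ l : ℕ) : ℝ) :=
    sum_le_sum_of_subset_of_nonneg (filter_subset _ _) fun _ _ _ => by positivity
  have hsmall : ((T.filter P).card : ℝ) ≤ (s : ℝ) ^ t := by exact_mod_cast card_filter_tdeg_lt_le T s
  have hcard : ((T.filter fun γ => ¬ P γ).card : ℝ) = T.card - (T.filter P).card := by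
    have := congrArg (fun n : ℕ => (n : ℝ)) hsplit
    push_cast at this
    linarith
  calc (s : ℝ) * (T.card - (s : ℝ) ^ t) ≤ (s : ℝ) * (T.filter fun γ => ¬ P γ).card := by
        rw [hcard]; gcongr
    _ ≤ _ := hbig.trans hle

/-- **`∑_{γ ∈ T} |γ| ≥ ¼ (#T)^{1+1/t} − #T`** for a finite set `T` of multi-indices of `ℕᵗ`, `t ≥ 1`. -/
theorem quarter_rpow_sub_le_sum_tdeg : ∀ {t : ℕ}, 1 ≤ t → ∀ T : Finset (Fin t → ℕ), (1 / 4 : ℝ) * (T.card : ℝ) ^ (1 + 1 / (t : ℝ)) - T.card ≤ ∑ γ ∈ T, ((∑ l, γ l : ℕ) : ℝ) := by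
  intro t ht T
  set k : ℝ := (T.card : ℝ) with hk
  have hk0 : 0 ≤ k := by positivity
  have ht0 : (0 : ℝ) < t := by exact_mod_cast ht
  have hti : 0 < 1 / (t : ℝ) := by positivity
  -- s = ⌊(k/2)^{1/t}⌋
  set y : ℝ := (k / 2) ^ (1 / (t : ℝ)) with hy
  have hy0 : 0 ≤ y := Real.rpow_nonneg (by positivity) _
  set s : ℕ := ⌊y⌋₊ with hs
  have hsy : (s : ℝ) ≤ y := Nat.floor_le hy0
  have hys : y - 1 ≤ s := by have := Nat.lt_floor_add_one y; linarith
  -- s^t ≤ k/2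
  have hst : (s : ℝ) ^ t ≤ k / 2 := by
    have h1 : (s : ℝ) ^ t = ((s : ℝ) ^ (t : ℝ)) := by rw [Real.rpow_natCast]
    rw [h1]
    calc (s : ℝ) ^ (t : ℝ) ≤ y ^ (t : ℝ) := Real.rpow_le_rpow (by positivity) hsy ht0.le
      _ = k / 2 := by
          rw [hy, ← Real.rpow_mul (by positivity), one_div_mul_cancel ht0.ne', Real.rpow_one]
  have hmain := mul_sub_le_sum_tdeg T s
  -- s (k - s^t) ≥ s k/2 ≥ (y-1) k/2 = y k/2 - k/2
  have h2 : (s : ℝ) * (k - (s : ℝ) ^ t) ≥ (y - 1) * (k / 2) := by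
    have hs0 : (0 : ℝ) ≤ s := by positivity
    calc (s : ℝ) * (k - (s : ℝ) ^ t) ≥ (s : ℝ) * (k / 2) := by gcongr; linarith
      _ ≥ (y - 1) * (k / 2) := by gcongr
  -- y k/2 = (k/2)^{1+1/t} ≥ k^{1+1/t}/4
  have h3 : y * (k / 2) = (k / 2) ^ (1 + 1 / (t : ℝ)) := by
    rw [hy, Real.rpow_add' (by positivity) (by positivity), Real.rpow_one, mul_comm]
  have h4 : (1 / 4 : ℝ) * k ^ (1 + 1 / (t : ℝ)) ≤ (k / 2) ^ (1 + 1 / (t : ℝ)) := by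
    rw [Real.div_rpow hk0 (by norm_num), le_div_iff₀ (by positivity)]
    have h22 : (2 : ℝ) ^ (1 + 1 / (t : ℝ)) ≤ 4 := by
      calc (2 : ℝ) ^ (1 + 1 / (t : ℝ)) ≤ (2 : ℝ) ^ (2 : ℝ) := by
            refine Real.rpow_le_rpow_of_exponent_le (by norm_num) ?_
            have : 1 / (t : ℝ) ≤ 1 := by rw [div_le_one ht0]; exact_mod_cast ht
            linarith
        _ = 4 := by norm_num
    have hkp : 0 ≤ k ^ (1 + 1 / (t : ℝ)) := Real.rpow_nonneg hk0 _
    nlinarith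
  have hmain' : (s : ℝ) * (k - (s : ℝ) ^ t) ≤ ∑ γ ∈ T, ((∑ l, γ l : ℕ) : ℝ) := hmain
  linarith [h2, h3, h4, hmain']


end Summit.Schanuel.Schanuel.Cruxes.ApproximationProperty.OrbitInterpolationDeterminant
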